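import Summits.HodgeConjecture.HodgeConjecture.Theorems.LinearSystemTorelliLocalTubeSpanTypedAssemblyVanishing
import Summits.HodgeConjecture.HodgeConjecture.Theorems.LinearSystemTorelliLocalTubeSpanRadical
import Summits.HodgeConjecture.HodgeConjecture.Theorems.LinearSystemTorelliLocalTubeSpanDistinguishedBasis

/-!
# Route LinearSystemTorelli — crux `LocalTubeSpan` (stmt-HodgeConjecture-2490): typed instances — the isolated singular point (unconditional) and the complete orbit (conditional)

Helper file (`--supports stmt-HodgeConjecture-2490`, line `Sketch` of the crux chain, cycle 5,
compositions by the lead; companion of `…TypedAssembly` / `…TypedAssemblyVanishing`, which carry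
the NORMAL-CROSSING NODAL member).

The line's case analysis of local Picard–Lefschetz configurations (crux NOTES.md in the crux
workfile directory) has two further geometric types whose algebra is landed; this file states them
ON THE TREE'S OBJECTS (`HyperplaneSectionLocalSystem`, `localSubgroup`, `localKernelOn`, the
rational monodromy `DirectImageLocalSystem.ratMonodromy`), at a path-connected piece `N` from a
presentation of ONE local subgroup:

* `localTubeSpan_localKernelOn_eq_iInf_ker_of_distinguishedBasis` (+ `…_vanishing_…`) — the
  ISOLATED SINGULAR POINT, UNCONDITIONALLY: the local subgroup is generated by finitely many
  elements acting on `Hᵏ(X_s(ℂ); ℚ)` as transvections `x ↦ x - B(x, δᵢ) δᵢ` of an alternating form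
  along LINEARLY INDEPENDENT cycles with connected diagram (Brieskorn–Gabrielov: meridians along a
  distinguished basis of the Milnor lattice) ⇒ the typed statement at `N`
  (`localTubeSpan_injective_evalCoinv_of_distinguishedBasis`, no named fact);
* `localTubeSpan_localKernelOn_eq_iInf_ker_of_completeOrbit` (+ `…_vanishing_…`) — ONE COMPLETE
  ORBIT (the non-isolated members `Y₁ ∪ Y₂`, cone over the dual variety of `Z = Y₁ ∩ Y₂`),
  CONDITIONAL on the named fact `Schnell2010_lemma11` (Janssen): the local subgroup is generated
  by elements acting as transvections along a set `Δ ⊆ Hᵏ(X_s(ℂ); ℚ)` which is a single orbit of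
  the local subgroup, realised, finitely generated over `ℤ`, integral, and contains a pair with
  `⟨δ₁, δ₂⟩ = 1` ⇒ the typed statement at `N` (`localTubeSpan_injective_evalCoinv_of_completeOrbit`).

Together with the NC-nodal instance this is the typed coverage table of the line: unconditional at
NC-nodal members and isolated singular points, conditional (Lemma 11) at complete orbits with
dependent generators.  No `sorry`; the only named fact is the explicit hypothesis `hL11`.
-/

-- `Summit.HodgeConjecture.HodgeConjecture.Theorems` is the mandated namespace (single-conjunct summit:
-- Sub = Summit), which `linter.dupNamespace` flags on every declaration; the lakefile turns the
-- linter off tree-wide (weak option), restated here so stand-alone elaboration is warning-free too.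
set_option linter.dupNamespace false

noncomputable section

open CategoryTheory groupCohomology
open _root_.Topology Filter
open Literature.AlgebraicGeometry Literature.AlgebraicGeometry.HodgeTheory
open Literature.AlgebraicTopology.SingularHomology

namespace Summit.HodgeConjecture.HodgeConjecture.Theorems

universe v

variable {𝒳 Sb : Motives.SchemeOver ℂ} {π : 𝒳 ⟶ Sb} {n : ℕ} {T : Type v} [TopologicalSpace T]

/-! ### The isolated singular point (distinguished basis), unconditionally -/

/-- **`ℚ`-cyclic detection at a local subgroup presented by a distinguished basis.**  If
`S ≤ π₁(U, s)` is generated by finitely many elements `tᵢ` acting on `Hᵏ(X_s(ℂ); ℚ)` through the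
rational monodromy as the transvections `x ↦ x - B(x, δᵢ) δᵢ` of an alternating form `B` along
linearly independent cycles `δᵢ`, no one of them `B`-orthogonal to all (connected diagram), then
Schnell's third map of the rational monodromy restricted to `S` is injective
(`localTubeSpan_injective_evalCoinv_of_distinguishedBasis`; no named fact). -/
theorem localTubeSpan_injective_evalCoinv_res_rat_of_distinguishedBasis
    (D : DirectImageLocalSystem π n) (k : ℕ) (s : smoothFiberLocus π n)
    (S : Subgroup (FundamentalGroup (smoothFiberLocus π n) s))
    (B : LinearMap.BilinForm ℚ (Motives.bettiCohomology (Motives.fiberOver π s.1) k)) (hB : B.IsAlt)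
    {r : ℕ} (t : Fin r → S) (ht : Subgroup.closure (Set.range t) = ⊤)
    (δ : Fin r → Motives.bettiCohomology (Motives.fiberOver π s.1) k) (hli : LinearIndependent ℚ δ)
    (hPL : ∀ (i : Fin r) (x : Motives.bettiCohomology (Motives.fiberOver π s.1) k),
      D.ratMonodromy k s (t i : FundamentalGroup (smoothFiberLocus π n) s) x = x - B x (δ i) • δ i)
    (hconn : ∀ i : Fin r, ∃ j : Fin r, B (δ i) (δ j) ≠ 0) :
    Function.Injective (evalCoinv (Rep.res S.subtype (Rep.of (D.ratMonodromy k s)))) := by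
  haveI : FiniteDimensional ℚ (Rep.res S.subtype (Rep.of (D.ratMonodromy k s))).V :=
    (localTubeSpan_ratTensorEquiv D k s _ (D.ofRatClass_ratMonodromy k s)).1
  exact localTubeSpan_injective_evalCoinv_of_distinguishedBasis
    (Rep.res S.subtype (Rep.of (D.ratMonodromy k s))) B hB t ht δ hli (fun i x => hPL i x) hconn

/-- **The isolated singular point on the tree's objects, unconditionally.**  One local subgroup at
the path-connected piece `N` presented by a distinguished basis (as in
`localTubeSpan_injective_evalCoinv_res_rat_of_distinguishedBasis`) ⇒ `localKernelOn ι (D.V k) s N`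
is exactly the space of classes undetected on all local subgroups at `N`. -/
theorem localTubeSpan_localKernelOn_eq_iInf_ker_of_distinguishedBasis
    (ι : C(smoothFiberLocus π n, T)) (D : DirectImageLocalSystem π n) (k : ℕ)
    (s : smoothFiberLocus π n) (N : Set T) (hN : IsPathConnected (ι ⁻¹' N))
    {s' : smoothFiberLocus π n} (hs' : ι s' ∈ N) (γ : Path s' s)
    (B : LinearMap.BilinForm ℚ (Motives.bettiCohomology (Motives.fiberOver π s.1) k)) (hB : B.IsAlt)
    {r : ℕ} (t : Fin r → localSubgroup ι s N hs' γ) (ht : Subgroup.closure (Set.range t) = ⊤)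
    (δ : Fin r → Motives.bettiCohomology (Motives.fiberOver π s.1) k) (hli : LinearIndependent ℚ δ)
    (hPL : ∀ (i : Fin r) (x : Motives.bettiCohomology (Motives.fiberOver π s.1) k),
      D.ratMonodromy k s (t i : FundamentalGroup (smoothFiberLocus π n) s) x = x - B x (δ i) • δ i)
    (hconn : ∀ i : Fin r, ∃ j : Fin r, B (δ i) (δ j) ≠ 0) :
    localKernelOn ι (D.V k) s N =
      ⨅ (s₂ : smoothFiberLocus π n) (hs₂ : ι s₂ ∈ N) (γ₂ : Path s₂ s),
        LinearMap.ker (evalCoinvOn (monodromyRepObj (D.V k) s) (localSubgroup ι s N hs₂ γ₂)) :=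
  localTubeSpan_localKernelOn_eq_iInf_ker_of_rat ι D k s N hN hs' γ
    (localTubeSpan_injective_evalCoinv_res_rat_of_distinguishedBasis D k s _ B hB t ht δ hli hPL hconn)

/-- **The isolated singular point on the VANISHING carrier, unconditionally** (modulo the
Lefschetz splitting `IsCompl`). -/
theorem localTubeSpan_localKernelOn_vanishing_eq_iInf_ker_of_distinguishedBasis
    {X : Motives.SchemeOver ℂ} {j : 𝒳 ⟶ X} (ι : C(smoothFiberLocus π n, T))
    (D : HyperplaneSectionLocalSystem π n j) (μ : OrientationFamily) {m b : ℕ}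
    (hX : Motives.IsSmoothProjective m X) (hb : n + 2 * m = b + 2 * n) (s : smoothFiberLocus π n)
    (hcompl : IsCompl (vanishing π n j μ hX hb s)
      (LinearMap.range (complexBetti.map (Motives.fiberι π s.1 ≫ j) n).hom))
    (N : Set T) (hN : IsPathConnected (ι ⁻¹' N)) {s' : smoothFiberLocus π n} (hs' : ι s' ∈ N)
    (γ : Path s' s)
    (B : LinearMap.BilinForm ℚ (Motives.bettiCohomology (Motives.fiberOver π s.1) n)) (hB : B.IsAlt)
    {r : ℕ} (t : Fin r → localSubgroup ι s N hs' γ) (ht : Subgroup.closure (Set.range t) = ⊤)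
    (δ : Fin r → Motives.bettiCohomology (Motives.fiberOver π s.1) n) (hli : LinearIndependent ℚ δ)
    (hPL : ∀ (i : Fin r) (x : Motives.bettiCohomology (Motives.fiberOver π s.1) n),
      D.toDirectImageLocalSystem.ratMonodromy n s (t i : FundamentalGroup (smoothFiberLocus π n) s) x =
        x - B x (δ i) • δ i)
    (hconn : ∀ i : Fin r, ∃ j : Fin r, B (δ i) (δ j) ≠ 0) :
    localKernelOn ι (D.vanishingLocalSystem μ hX hb) s N =
      ⨅ (s₂ : smoothFiberLocus π n) (hs₂ : ι s₂ ∈ N) (γ₂ : Path s₂ s),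
        LinearMap.ker (evalCoinvOn (monodromyRepObj (D.vanishingLocalSystem μ hX hb) s)
          (localSubgroup ι s N hs₂ γ₂)) :=
  localTubeSpan_localKernelOn_vanishing_eq_iInf_ker_of_rat ι D μ hX hb s hcompl N hN hs' γ
    (localTubeSpan_injective_evalCoinv_res_rat_of_distinguishedBasis D.toDirectImageLocalSystem n s _
      B hB t ht δ hli hPL hconn)

/-! ### One complete orbit (the non-isolated members), conditional on Schnell's Lemma 11 -/

/-- **`ℚ`-cyclic detection at a local subgroup presented by ONE COMPLETE ORBIT**, conditional on
`Schnell2010_lemma11`: `S ≤ π₁(U, s)` is generated by a set of elements acting on `Hᵏ(X_s(ℂ); ℚ)`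
through the rational monodromy as transvections of an alternating form `B` along members of a set
`Δ` of cycles which is realised (`T_δ ∈ ρ(S)` for `δ ∈ Δ`), finitely generated over `ℤ`, integral,
`S`-stable, a single `S`-orbit, and contains a pair with `⟨δ₁, δ₂⟩ = 1` ⇒ Schnell's third map of
the rational monodromy restricted to `S` is injective
(`localTubeSpan_injective_evalCoinv_of_completeOrbit`). -/
theorem localTubeSpan_injective_evalCoinv_res_rat_of_completeOrbit (hL11 : Schnell2010_lemma11)
    (D : DirectImageLocalSystem π n) (k : ℕ) (s : smoothFiberLocus π n)
    (S : Subgroup (FundamentalGroup (smoothFiberLocus π n) s))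
    (B : LinearMap.BilinForm ℚ (Motives.bettiCohomology (Motives.fiberOver π s.1) k)) (hB : B.IsAlt)
    (Δ : Set (Motives.bettiCohomology (Motives.fiberOver π s.1) k)) (gen : Set S)
    (hgen : Subgroup.closure gen = ⊤)
    (hgenΔ : ∀ t ∈ gen, ∃ δ ∈ Δ, ∀ x,
      D.ratMonodromy k s (t : FundamentalGroup (smoothFiberLocus π n) s) x = x - B x δ • δ)
    (hΔS : ∀ δ ∈ Δ, ∃ g : S, ∀ x,
      D.ratMonodromy k s (g : FundamentalGroup (smoothFiberLocus π n) s) x = x - B x δ • δ)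
    (hfg : (Submodule.span ℤ Δ).FG) (hint : ∀ δ ∈ Δ, ∀ δ' ∈ Δ, ∃ z : ℤ, B δ δ' = z)
    (hstable : ∀ (g : S), ∀ δ ∈ Δ,
      D.ratMonodromy k s (g : FundamentalGroup (smoothFiberLocus π n) s) δ ∈ Δ)
    (htrans : ∀ δ ∈ Δ, ∀ δ' ∈ Δ, ∃ g : S,
      D.ratMonodromy k s (g : FundamentalGroup (smoothFiberLocus π n) s) δ = δ')
    (hpair : ∃ δ₁ ∈ Δ, ∃ δ₂ ∈ Δ, B δ₁ δ₂ = 1) :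
    Function.Injective (evalCoinv (Rep.res S.subtype (Rep.of (D.ratMonodromy k s)))) := by
  haveI : FiniteDimensional ℚ (Rep.res S.subtype (Rep.of (D.ratMonodromy k s))).V :=
    (localTubeSpan_ratTensorEquiv D k s _ (D.ofRatClass_ratMonodromy k s)).1
  exact localTubeSpan_injective_evalCoinv_of_completeOrbit
    (Rep.res S.subtype (Rep.of (D.ratMonodromy k s))) hL11 B hB Δ gen hgen
    (fun t ht' => hgenΔ t ht') (fun δ hδ => hΔS δ hδ) hfg hint (fun g δ hδ => hstable g δ hδ)
    (fun δ hδ δ' hδ' => htrans δ hδ δ' hδ') hpair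

/-- **One complete orbit on the tree's objects** (the non-isolated member `Y₁ ∪ Y₂`), conditional on
`Schnell2010_lemma11`: a complete-orbit presentation of one local subgroup at the path-connected
piece `N` ⇒ `localKernelOn ι (D.V k) s N` is exactly the space of classes undetected on all local
subgroups at `N`. -/
theorem localTubeSpan_localKernelOn_eq_iInf_ker_of_completeOrbit (hL11 : Schnell2010_lemma11)
    (ι : C(smoothFiberLocus π n, T)) (D : DirectImageLocalSystem π n) (k : ℕ)
    (s : smoothFiberLocus π n) (N : Set T) (hN : IsPathConnected (ι ⁻¹' N))
    {s' : smoothFiberLocus π n} (hs' : ι s' ∈ N) (γ : Path s' s)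
    (B : LinearMap.BilinForm ℚ (Motives.bettiCohomology (Motives.fiberOver π s.1) k)) (hB : B.IsAlt)
    (Δ : Set (Motives.bettiCohomology (Motives.fiberOver π s.1) k))
    (gen : Set (localSubgroup ι s N hs' γ)) (hgen : Subgroup.closure gen = ⊤)
    (hgenΔ : ∀ t ∈ gen, ∃ δ ∈ Δ, ∀ x,
      D.ratMonodromy k s (t : FundamentalGroup (smoothFiberLocus π n) s) x = x - B x δ • δ)
    (hΔS : ∀ δ ∈ Δ, ∃ g : localSubgroup ι s N hs' γ, ∀ x,
      D.ratMonodromy k s (g : FundamentalGroup (smoothFiberLocus π n) s) x = x - B x δ • δ)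
    (hfg : (Submodule.span ℤ Δ).FG) (hint : ∀ δ ∈ Δ, ∀ δ' ∈ Δ, ∃ z : ℤ, B δ δ' = z)
    (hstable : ∀ (g : localSubgroup ι s N hs' γ), ∀ δ ∈ Δ,
      D.ratMonodromy k s (g : FundamentalGroup (smoothFiberLocus π n) s) δ ∈ Δ)
    (htrans : ∀ δ ∈ Δ, ∀ δ' ∈ Δ, ∃ g : localSubgroup ι s N hs' γ,
      D.ratMonodromy k s (g : FundamentalGroup (smoothFiberLocus π n) s) δ = δ')
    (hpair : ∃ δ₁ ∈ Δ, ∃ δ₂ ∈ Δ, B δ₁ δ₂ = 1) :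
    localKernelOn ι (D.V k) s N =
      ⨅ (s₂ : smoothFiberLocus π n) (hs₂ : ι s₂ ∈ N) (γ₂ : Path s₂ s),
        LinearMap.ker (evalCoinvOn (monodromyRepObj (D.V k) s) (localSubgroup ι s N hs₂ γ₂)) :=
  localTubeSpan_localKernelOn_eq_iInf_ker_of_rat ι D k s N hN hs' γ
    (localTubeSpan_injective_evalCoinv_res_rat_of_completeOrbit hL11 D k s _ B hB Δ gen hgen hgenΔ
      hΔS hfg hint hstable htrans hpair)

/-- **One complete orbit on the VANISHING carrier** (the non-isolated member `Y₁ ∪ Y₂`),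
conditional on `Schnell2010_lemma11` and the Lefschetz splitting. -/
theorem localTubeSpan_localKernelOn_vanishing_eq_iInf_ker_of_completeOrbit
    (hL11 : Schnell2010_lemma11) {X : Motives.SchemeOver ℂ} {j : 𝒳 ⟶ X}
    (ι : C(smoothFiberLocus π n, T)) (D : HyperplaneSectionLocalSystem π n j)
    (μ : OrientationFamily) {m b : ℕ} (hX : Motives.IsSmoothProjective m X)
    (hb : n + 2 * m = b + 2 * n) (s : smoothFiberLocus π n)
    (hcompl : IsCompl (vanishing π n j μ hX hb s)
      (LinearMap.range (complexBetti.map (Motives.fiberι π s.1 ≫ j) n).hom))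
    (N : Set T) (hN : IsPathConnected (ι ⁻¹' N)) {s' : smoothFiberLocus π n} (hs' : ι s' ∈ N)
    (γ : Path s' s)
    (B : LinearMap.BilinForm ℚ (Motives.bettiCohomology (Motives.fiberOver π s.1) n)) (hB : B.IsAlt)
    (Δ : Set (Motives.bettiCohomology (Motives.fiberOver π s.1) n))
    (gen : Set (localSubgroup ι s N hs' γ)) (hgen : Subgroup.closure gen = ⊤)
    (hgenΔ : ∀ t ∈ gen, ∃ δ ∈ Δ, ∀ x,
      D.toDirectImageLocalSystem.ratMonodromy n s (t : FundamentalGroup (smoothFiberLocus π n) s) x =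
        x - B x δ • δ)
    (hΔS : ∀ δ ∈ Δ, ∃ g : localSubgroup ι s N hs' γ, ∀ x,
      D.toDirectImageLocalSystem.ratMonodromy n s (g : FundamentalGroup (smoothFiberLocus π n) s) x =
        x - B x δ • δ)
    (hfg : (Submodule.span ℤ Δ).FG) (hint : ∀ δ ∈ Δ, ∀ δ' ∈ Δ, ∃ z : ℤ, B δ δ' = z)
    (hstable : ∀ (g : localSubgroup ι s N hs' γ), ∀ δ ∈ Δ,
      D.toDirectImageLocalSystem.ratMonodromy n s (g : FundamentalGroup (smoothFiberLocus π n) s) δ ∈ Δ)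
    (htrans : ∀ δ ∈ Δ, ∀ δ' ∈ Δ, ∃ g : localSubgroup ι s N hs' γ,
      D.toDirectImageLocalSystem.ratMonodromy n s (g : FundamentalGroup (smoothFiberLocus π n) s) δ = δ')
    (hpair : ∃ δ₁ ∈ Δ, ∃ δ₂ ∈ Δ, B δ₁ δ₂ = 1) :
    localKernelOn ι (D.vanishingLocalSystem μ hX hb) s N =
      ⨅ (s₂ : smoothFiberLocus π n) (hs₂ : ι s₂ ∈ N) (γ₂ : Path s₂ s),
        LinearMap.ker (evalCoinvOn (monodromyRepObj (D.vanishingLocalSystem μ hX hb) s)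
          (localSubgroup ι s N hs₂ γ₂)) :=
  localTubeSpan_localKernelOn_vanishing_eq_iInf_ker_of_rat ι D μ hX hb s hcompl N hN hs' γ
    (localTubeSpan_injective_evalCoinv_res_rat_of_completeOrbit hL11 D.toDirectImageLocalSystem n s _
      B hB Δ gen hgen hgenΔ hΔS hfg hint hstable htrans hpair)

end Summit.HodgeConjecture.HodgeConjecture.Theorems

end
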